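import Summits.ResolutionOfSingularities.ResolutionOfSingularities.Theses.Descent
import Summits.ResolutionOfSingularities.ResolutionOfSingularities.Theses.PAlteration
import Literature.AlgebraicGeometry.Resolution.QuasiProjectiveResolution
import Literature.AlgebraicGeometry.Resolution.MaximalContact
import Mathlib.AlgebraicGeometry.Morphisms.Smooth
import Mathlib.AlgebraicGeometry.Morphisms.Finite
import Mathlib.AlgebraicGeometry.Morphisms.UniversallyInjective
import HarnessLib

/-!
# Uniform Frobenius level, the smooth-base normal form, and uniform resolution over ALL fields of
# characteristic `p` — crux workfile, lens 4 («uniformity / ultraproduct conditional bridge»), seat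
# res-B-lens-4 gen 9 (stmt-ResolutionOfSingularities-0549 `Theses.Descent.DescentPerfectToAll`)

[OURS · CANDIDATE] counted 0; nothing here proves resolution of singularities in characteristic p.
CENSUS-GRADE typing (memo `UNIFORM-LEVEL-lens4-g9.md`), not a line: no `DescentPerfectToAll_of` over registered
stubs is claimed and `ledger skeleton check` is NOT run from this seat (registrar ruling 2026-08-29T01:05Z).

## What is typed (all `Prop`s are statements; every `theorem` below is proved, no `sorry`)

* `ResOver K`, `PerfectRes p` — resolution over one field / over all perfect fields of char `p` (as in gens 0, 7).
* `PicoverSmooth p` — **the smooth-base normal form of the residual problem**: a finite, universally injective,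
  surjective cover `X → Z` of a SMOOTH separated finite-type `k`-scheme `Z`, `X` integral, has a resolution.
  It is `PAlteration.Picover` (stmt-0554) with `IsRegular Z` strengthened to `Smooth (Z → Spec k)` (so it is
  implied by `Picover`: `picoverSmooth_of_picover`) and, like `Picover`, it is implied by the summit
  (`picoverSmooth_of_resolutionInChar`).
* `FrobeniusSmoothing p` — **every integral variety is, up to a proper birational modification, a finite radicial
  cover of a smooth variety**.  Memo Thm S: `PerfectRes p → FrobeniusSmoothing p` (paper proof: resolve
  `(X ⊗_K K^{perf})_red` over the perfect closure, descend the resolution to a finite Frobenius level `K^{1/pⁿ}` where it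
  is SMOOTH, transport along `Frob^n : K^{1/pⁿ} ≅ K` to a smooth resolution `Z` of the Frobenius twist `(X^{(pⁿ)})_red`,
  and pull back along the relative Frobenius `X → X^{(pⁿ)}`); memo Thm L adds, by Łoś over the elementary class of
  ALL fields of characteristic `p`, that the level `n` and the complexity of `Z` are bounded in terms of the complexity
  of `X` alone (uniform Frobenius level) — the uniformity is free and is not used below.
* PROVED bookkeeping: `resOverIntegral_of_frobeniusSmoothing_of_picoverSmooth` (the two Props resolve every integral
  variety over `k`), `descentPerfectToAll_of_smoothNormalForm` (with the landed reduced→integral item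
  `Descent.DescentReducedToIntegral` they recompose the crux BY NAME), and the two implications placing
  `PicoverSmooth` between `Picover` and the summit.  Net: **`R0_p ⟺ PerfectRes_p ∧ PicoverSmooth_p`** modulo the
  paper-proved Thm S — a NORMAL FORM of rung B (the antecedent is cashed as a smooth base), recorded with the honest
  verdict of the memo (§4: equivalent under `PerfectRes` to `Picover`; no patching / no canonicity is gained, the
  imperfect ground field survives in inseparable residue fields of `Z`; census, not a lever).
-/

set_option linter.dupNamespace false

namespace Summit.ResolutionOfSingularities.ResolutionOfSingularities.Cruxes.DescentPerfectToAll.UniformityG9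

open AlgebraicGeometry CategoryTheory Literature.AlgebraicGeometry.Resolution

universe u

/-- Resolution of singularities over the ground field `K` (reduced separated finite-type `K`-schemes). -/
def ResOver (K : Type) [Field K] : Prop :=
  ∀ (X : Scheme.{0}) (f : X ⟶ Spec (.of K)),
    IsSeparated f → LocallyOfFiniteType f → QuasiCompact f → IsReduced X → Scheme.HasResolution X

/-- The same for INTEGRAL `X` only (cf. the landed item `Descent.DescentReducedToIntegral`). -/
def ResOverIntegral (K : Type) [Field K] : Prop :=
  ∀ (X : Scheme.{0}) (f : X ⟶ Spec (.of K)),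
    IsSeparated f → LocallyOfFiniteType f → QuasiCompact f → IsIntegral X → Scheme.HasResolution X

/-- The crux's antecedent: resolution over every perfect field of characteristic `p`. -/
def PerfectRes (p : ℕ) : Prop :=
  ∀ (k : Type) [Field k] [CharP k p] [PerfectField k], ResOver k

/-- Unfolding of the Literature statement. [folklore] -/
theorem resolutionInChar_iff (p : ℕ) :
    ResolutionInChar.{0} p ↔ ∀ (K : Type) [Field K] [CharP K p], ResOver K := Iff.rfl

/-- **Smooth-base Picover** (`PicoverSmooth_p`): over any field `k` of characteristic `p`, an integral scheme `X`
admitting a finite, universally injective (radicial), surjective morphism onto a SMOOTH integral separated finite-type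
`k`-scheme `Z` has a resolution of singularities.  (`PAlteration.Picover` = the same with `Z` merely regular.) -/
def PicoverSmooth (p : ℕ) : Prop :=
  ∀ (k : Type) [Field k] [CharP k p] (Z X : Scheme.{0}) (f : Z ⟶ Spec (.of k)) (g : X ⟶ Z),
    IsSeparated f → LocallyOfFiniteType f → QuasiCompact f → Smooth f → IsIntegral Z → IsIntegral X →
    IsFinite g → UniversallyInjective g → Function.Surjective g.base → Scheme.HasResolution X

/-- **Frobenius smoothing** (`FrobeniusSmoothing_p`): every integral separated finite-type `k`-scheme `X` admits a
proper birational `π : X' → X` with `X'` integral and a finite, universally injective, surjective `g : X' → Z` onto a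
SMOOTH separated finite-type `k`-scheme `Z`.  Memo Thm S: a consequence of `PerfectRes p` (the level-`n` Frobenius
twist of `X` has a smooth resolution for `n ≫ 0`); memo Thm L: with `n` and the complexity of `Z` bounded in terms of
the complexity of `X` (Łoś).  Unconditionally FALSE as stated for no known `X`, and unconditionally TRUE in
dimension `≤ 3` (CP2019 + Thm S's proof) — it is recorded as a `Prop`, not claimed. -/
def FrobeniusSmoothing (p : ℕ) : Prop :=
  ∀ (k : Type) [Field k] [CharP k p] (X : Scheme.{0}) (f : X ⟶ Spec (.of k)),
    IsSeparated f → LocallyOfFiniteType f → QuasiCompact f → IsIntegral X →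
    ∃ (X' Z : Scheme.{0}) (π : X' ⟶ X) (g : X' ⟶ Z) (h : Z ⟶ Spec (.of k)),
      IsProper π ∧ IsBirational π ∧ IsIntegral X' ∧
      IsSeparated h ∧ LocallyOfFiniteType h ∧ QuasiCompact h ∧ Smooth h ∧ IsIntegral Z ∧
      IsFinite g ∧ UniversallyInjective g ∧ Function.Surjective g.base

/-- The two normal-form statements resolve every integral variety over `k`. [folklore] -/
theorem resOverIntegral_of_frobeniusSmoothing_of_picoverSmooth {p : ℕ}
    (hS : FrobeniusSmoothing p) (hP : PicoverSmooth p)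
    (k : Type) [Field k] [CharP k p] : ResOverIntegral k := by
  intro X f hsep hft hqc hint
  obtain ⟨X', Z, π, g, h, hπ, hbir, hX', hh₁, hh₂, hh₃, hh₄, hZ, hg₁, hg₂, hg₃⟩ := hS k X f hsep hft hqc hint
  haveI := hπ
  exact Scheme.HasResolution.of_isBirational π hbir (hP k Z X' h g hh₁ hh₂ hh₃ hh₄ hZ hX' hg₁ hg₂ hg₃)

/-- Recomposition BY NAME: Frobenius smoothing (from the antecedent) + smooth-base Picover + the landed
reduced-to-integral item give route Descent's crux `DescentPerfectToAll`. [folklore] -/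
theorem descentPerfectToAll_of_smoothNormalForm
    (hS : ∀ p : ℕ, p.Prime → PerfectRes p → FrobeniusSmoothing p)
    (hP : ∀ p : ℕ, p.Prime → PerfectRes p → PicoverSmooth p)
    (hRed : Theses.Descent.DescentReducedToIntegral) :
    Theses.Descent.DescentPerfectToAll := by
  intro p hp hperf k _ _ X f hsep hft hqc hred
  have hPR : PerfectRes p := fun k _ _ _ X f hs hl hq hr => hperf k X f hs hl hq hr
  haveI := hred
  exact hRed k (fun X f hs hl hq hi =>
    resOverIntegral_of_frobeniusSmoothing_of_picoverSmooth (hS p hp hPR) (hP p hp hPR) k X f hs hl hq hi)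
    X f hsep hft hqc inferInstance

/-- The summit at `p` implies smooth-base Picover at `p` (so `PicoverSmooth` is irrefutable short of a
counterexample to resolution itself). [folklore] -/
theorem picoverSmooth_of_resolutionInChar {p : ℕ} (h : ResolutionInChar.{0} p) : PicoverSmooth p := by
  intro k _ _ Z X f g hsep hft hqc _ _ hint _ _ _
  haveI := hsep; haveI := hft; haveI := hqc
  haveI : IsReduced X := inferInstance
  exact h k X (g ≫ f) inferInstance inferInstance inferInstance inferInstance

/-- `Picover` (regular base, stmt-0554) implies `PicoverSmooth` (smooth base): smooth over a field ⇒ regular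
(`Scheme.isRegular_of_smooth_over_field`). [folklore] -/
theorem picoverSmooth_of_picover (h : Theses.PAlteration.Picover) {p : ℕ} (hp : p.Prime) :
    PicoverSmooth p := by
  intro k _ _ Z X f g hsep hft hqc hsm hZ hint hfin huniv hsurj
  letI : Z.Over (Spec (.of k)) := ⟨f⟩
  haveI : Smooth (Z ↘ Spec (.of k)) := hsm
  have hreg : Scheme.IsRegular Z := Scheme.isRegular_of_smooth_over_field k Z
  exact h p hp k Z X f g hsep hft hqc hZ hreg hint hfin huniv hsurj

end Summit.ResolutionOfSingularities.ResolutionOfSingularities.Cruxes.DescentPerfectToAll.UniformityG9
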